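import Literature.AlgebraicGeometry.Resolution.HasseSchmidtDerivatives
import Mathlib.RingTheory.MvPolynomial.Ideal
import HarnessLib

/-!
# Barrier: a filtration that is Diff-stable from a non-negative source degree and carries a «(37)-type» element
# has NO proper negative part («NegativePartCollapseUnderDiffStability»)

`Literature/Barriers/ResolutionOfSingularities/NegativePartCollapseUnderDiffStability.lean` — barrier catalogue entry
(D-0021) for the summit `ResolutionOfSingularities`, filed at the request of the LADDER-RESOLUTION cell `res-hironaka`
(director-resolution 2026-08-27T01:55:25Z (4); finding of record «res-adj-1 E-B (kernel)», G1 INTERFACE CHECK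
01:41:03Z, evidence file `pub/res-hironaka/ledger/group-1/INTERFACE-CHECK-v02-kernel.lean` sha16 `ffc08c73dddd7ea4`, section
`Bare`: `squeeze_pos_source`, `squeeze_zero_source`; E-E note of `pub/res-hironaka/D/res-D-plan-1/PNEGA-INTERFACE-v0.2-delta.md`).
The formal core is PROVED here for every commutative base ring `K`, every commutative `K`-algebra `B`, every family of
additive subgroups `T : ℤ → AddSubgroup B` («graded pieces», degree `i`); a specimen on the affine line shows the
hypotheses are met by the simplest differential-operator recipe.

## The phenomenon

Grothendieck's differential operators of order `≤ n` of a `K`-algebra `B` (`Resolution.IsDiffOpLE K n D`,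
ÉGA IV₄ Déf. 16.8.1 / Prop. 16.8.8 (b)) form a left `B`-module: «`aD` est l'opérateur différentiel qui, à toute section
`t` …, fait correspondre la section `(aD)(t) = a(D(t))`» [cite: EGAIV4, (16.8.5) and Eq. (16.8.5.1)] — in the tree
`Resolution.IsDiffOpLE.smul` [cite: EGAIV4, Déf. 16.8.1 (Diff^n is an 𝒪_X-module)] — and an operator of order `≤ q` has
order `≤ q + a` (`IsDiffOpLE.of_le`) [cite: EGAIV4, Déf. 16.8.1 and Prop. 16.8.8 (b)]. Hence:

**(S1) crossing from a non-negative source degree.** Let `T : ℤ → AddSubgroup B` be any family and `q ≥ 0`. Suppose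
`T` is *Diff-stable from source degree `q` into the negative degrees*: every operator `D` of order `≤ q + a` maps `T(q)`
into `T(−a)` (`a ≥ 0`). Suppose `T(q)` contains a **(37)-type element**: some `g ∈ T(q)` and some operator `D₀` of order
`≤ q` with `D₀ g` a unit. Then `T(−a) = B` for EVERY `a ≥ 0`: for any `h ∈ B` the operator `(h (D₀ g)⁻¹)·D₀` has order
`≤ q ≤ q + a` and sends `g` to `h` (`NegativePartCollapse.negPiece_eq_top`, res-adj-1's exact forms
`NegativePartCollapse.squeeze_pos_source` / `squeeze_zero_source`). **No multiplicative structure, no antitonicity, no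
`p`, no Noetherian or regularity hypothesis is used** — only additivity of the pieces and the module structure of `Diff`.

**(S3) crossing through the boundary instead (E-E).** If Diff-stability is demanded only from NEGATIVE source degrees but
the pieces are antitone ACROSS the boundary (`T(q) ⊆ T(−1)`), the same squeeze gives `T(−1−q−a) = B` for all `a ≥ 0`
(`NegativePartCollapse.negPiece_eq_top_of_crossBoundary`).

Headline (`NegativePartCollapseUnderDiffStability`): there is NO family `T` that is Diff-stable from a source degree
`q ≥ 0` into the negative degrees, carries a (37)-type element in degree `q`, and has a proper piece `T(−a) ≠ B` in some
degree `−a ≤ 0`.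

**Specimen** (`NegativePartCollapse.specimen_affineLine`): `B = K[x]` (`MvPolynomial (Fin 1) K`), `𝔪 = (x)`, `q ≥ 0`:
the one-term recipe «negative piece of degree `−a` := the ideal generated by `Diff^{≤ q+a}` applied to `𝔪^q`»
(`Resolution.diffIdeal K (q + a) (𝔪^q)`) satisfies the crossing hypothesis tautologically (`Resolution.apply_mem_diffIdeal`)
and `g = x^q ∈ 𝔪^q` is a (37)-type element through the Hasse–Schmidt derivative `D^{(q)}`, `D^{(q)}(x^q) = 1`
(`Resolution.hasseDeriv_X_pow`, `isDiffOpLE_hasseDeriv` [cite: EGAIV4, Thm. 16.11.2]); the barrier returns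
`Diff^{≤ q+a}(𝔪^q) = K[x]` for every `a`, every `K` — in particular in every characteristic `p > 0`.

## Application recorded here (cell res-hironaka, D-0089; HONEST FRAMING)

H. Hironaka, *Resolution of singularities in positive characteristics*, ms. 2017 [Hironaka2017] (lit key
`paper:url-3343fd9e678b`, PDF page = printed page) is an UNREFEREED MANUSCRIPT UNDER ADJUDICATION (D-0012); its statements
are typed as CANDIDATES under `Literature/AlgebraicGeometry/Hironaka2017/S*`, never asserted. Pages read for this entry:
p.25 l.31–44 (Def. 5.1, Eq. (36): «`℘̃(E,−a) = Σ_{d∈ℤ, dm ≥ |a|} D(m,a,d)`, `D(m,a,d) = Diff^{(dm+a)}_Z ℘posi(E,dm)`»), p.26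
l.25 (Eq. (37): «`∃ g ∈ ℘(E,m)_ξ, ord_ξ(g) = m > 0`»), p.26 l.36–37 («From now on throughout this section we will be assuming
the existence of the element `g` in Eq.(37) at every `ξ ∈ Sing(E)_cl`»), p.27 l.24 («where `Diff^{(md′−md)} g^{d′−d} =
O_{Z,ξ}` by the assumption on `g`», typed `S05NegativePart.U27L24`) [claim: Hironaka2017, status: under-review].
The typed Def. 5.1 recipe IS an instance of (S1) at every (37)-point (source degree `q = md`, operators `Diff^{(md+a)}_Z`,
(37)-type element `g^d` via p.27 l.24): the cell's kernel record of this is `res-adj-1-G1Collapse.lean` (GAP-LEDGER row R01,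
class DEFECT-definitional: «at every (37)-point `℘̃(E,−a)_ξ = O_ξ` for `a ≥ 0`») and, in the tree,
`S05NegativePart.pTildeNeg_natCast_eq_top_of_clause` / `S07Permissible.pNegaAt_eq_top_of_edgeDatum`
(`Proofs/S07Permissible/Thm7p12.lean`) — cited by name, not imported. The cell's ℘nega-INTERFACE (rescue rung L, group G1)
typed the requirements F2 (positive pieces = `℘(E,·)`), F3 (absolute Diff-stability from every source degree `≥ 0`) and F7b
(a proper negative piece at a (37)-datum) into one structure `PnegaInterfaceV2`; by (S1) that structure is EMPTY for every
candidate (director-resolution 2026-08-27T01:55:25Z: «no multiplicative antitone filtration that is absolutely Diff-stable from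
non-negative source degrees has a proper negative part»; interface V3 splits F3 accordingly). Nothing here is a claim about
resolution of singularities in characteristic `p`, nor a verdict on any printed sentence beyond the cell's GAP-LEDGER.

## References

* [EGAIV4] A. Grothendieck, J. Dieudonné, ÉGA IV₄, Publ. Math. IHÉS 32 (1967), §16.8: Déf. 16.8.1, (16.8.5)/(16.8.5.1)
  (left `𝒪_X`-module structure `(aD)(t) = a(D(t))`), Prop. 16.8.8 (b); Thm. 16.11.2 (the operators `D_q` on a polynomial
  algebra). Read via `lit read doi:10.1007/BF02732123` (pp. 39–41 of the held copy) for this entry.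
* [Hironaka2017] H. Hironaka, ms. 2017-03-23, §5 pp. 25–27 (UNDER ADJUDICATION; locators above).
-/

noncomputable section

namespace Literature.Barriers.ResolutionOfSingularities

open Literature.AlgebraicGeometry.Resolution

universe u v

/-! ## 1. The squeeze lemmas (structure-free) -/

namespace NegativePartCollapse

section Squeeze

variable (K : Type u) [CommRing K] {B : Type v} [CommRing B] [Algebra K B]

/-- **(S1), sharpest form.** If every operator of order `≤ q + a` maps `T(q)` into `T(−a)` (Diff-stability from the
source degree `q ≥ 0` into degree `−a`, `a ≥ 0`) and `T(q)` contains an element `g` on which some operator `D₀` of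
order `≤ q` takes a unit value, then `T(−a) = ⊤`: for `h ∈ B`, `(h·(D₀ g)⁻¹)·D₀` has order `≤ q ≤ q + a` and sends `g` to
`h`. Uses only that `Diff^{≤ n}` is a left `B`-module and increasing in `n`.
[cite: EGAIV4, (16.8.5) and Eq. (16.8.5.1); Déf. 16.8.1] -/
theorem negPiece_eq_top (T : ℤ → AddSubgroup B) (q a : ℕ)
    (hcross : ∀ D : B →ₗ[K] B, IsDiffOpLE K (q + a) D → ∀ f : B, f ∈ T q → D f ∈ T (-(a : ℤ)))
    (g : B) (hgT : g ∈ T q) (D₀ : B →ₗ[K] B) (hD₀ : IsDiffOpLE K q D₀) (hunit : IsUnit (D₀ g)) :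
    T (-(a : ℤ)) = ⊤ := by
  obtain ⟨u, hu⟩ := hunit
  refine (AddSubgroup.eq_top_iff' _).mpr fun h => ?_
  have hop : IsDiffOpLE K (q + a) ((h * ↑u⁻¹) • D₀) := (hD₀.smul (h * ↑u⁻¹)).of_le (Nat.le_add_right q a)
  have hmem := hcross _ hop g hgT
  rw [LinearMap.smul_apply, ← hu, smul_eq_mul, mul_assoc, Units.inv_mul, mul_one] at hmem
  exact hmem

/-- **(S1), res-adj-1's form `squeeze_pos_source`** (evidence file `INTERFACE-CHECK-v02-kernel.lean` ffc08c73dddd7ea4,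
l.44–53, ported verbatim in its hypotheses): `T` Diff-stable at source degree `q` for ALL orders
(`D f ∈ T(q − μ)` for every `D` of order `≤ μ`, `f ∈ T(q)`), and a (37)-type element `g ∈ T(q)`, `D₀ g = 1`, `ord D₀ ≤ q`
⟹ EVERY negative piece `T(−a)`, `a ≥ 0`, is everything. [cite: EGAIV4, (16.8.5) and Eq. (16.8.5.1); Déf. 16.8.1] -/
theorem squeeze_pos_source (T : ℤ → AddSubgroup B) (q : ℕ) (g : B) (hgT : g ∈ T q)
    (D : B →ₗ[K] B) (hD : IsDiffOpLE K q D) (hDg : D g = 1)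
    (hdiff : ∀ (μ : ℕ) (D : B →ₗ[K] B), IsDiffOpLE K μ D → ∀ f : B, f ∈ T q → D f ∈ T ((q : ℤ) - μ))
    (a : ℕ) : T (-(a : ℤ)) = ⊤ := by
  refine negPiece_eq_top K T q a (fun D' hD' f hf => ?_) g hgT D hD (by rw [hDg]; exact isUnit_one)
  have hidx : (q : ℤ) - ((q + a : ℕ) : ℤ) = -(a : ℤ) := by push_cast; ring
  simpa only [hidx] using hdiff (q + a) D' hD' f hf

/-- **(S2), res-adj-1's form `squeeze_zero_source`** (same file, l.59–66): Diff-stability at source degree `0` for all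
orders and a (37)-type element `g ∈ T(0)` of order `q` (`D₀ g = 1`, `ord D₀ ≤ q`) ⟹ `T(−q) = ⊤`. So restricting the
demanded Diff-stability to NON-POSITIVE source degrees does not avoid the collapse; only source degrees `< 0` do (and see
(S3) for what antitonicity across the boundary then re-imports). [cite: EGAIV4, (16.8.5) and Eq. (16.8.5.1); Déf. 16.8.1] -/
theorem squeeze_zero_source (T : ℤ → AddSubgroup B) (q : ℕ) (g : B) (hgT : g ∈ T 0)
    (D : B →ₗ[K] B) (hD : IsDiffOpLE K q D) (hDg : D g = 1)
    (hdiff0 : ∀ (μ : ℕ) (D : B →ₗ[K] B), IsDiffOpLE K μ D → ∀ f : B, f ∈ T 0 → D f ∈ T (-(μ : ℤ))) :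
    T (-(q : ℤ)) = ⊤ := by
  refine (AddSubgroup.eq_top_iff' _).mpr fun h => ?_
  have hmem := hdiff0 q (h • D) (hD.smul h) g hgT
  rw [LinearMap.smul_apply, hDg, smul_eq_mul, mul_one] at hmem
  exact hmem

/-- **(S3), crossing through the boundary (E-E of the cell's interface notes).** If Diff-stability is demanded only from
the NEGATIVE source degree `−1` (`D f ∈ T(−1−μ)` for `D` of order `≤ μ`, `f ∈ T(−1)`) but the pieces are antitone across
the boundary (`T(q) ⊆ T(−1)`), a (37)-type element `g ∈ T(q)` (`ord D₀ ≤ q`, `D₀ g` a unit) still forces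
`T(−1−q−a) = ⊤` for every `a ≥ 0`. [cite: EGAIV4, (16.8.5) and Eq. (16.8.5.1); Déf. 16.8.1] -/
theorem negPiece_eq_top_of_crossBoundary (T : ℤ → AddSubgroup B) (q a : ℕ)
    (hneg : ∀ (μ : ℕ) (D : B →ₗ[K] B), IsDiffOpLE K μ D → ∀ f : B, f ∈ T (-1) → D f ∈ T (-1 - (μ : ℤ)))
    (hcb : T q ≤ T (-1)) (g : B) (hgT : g ∈ T q) (D₀ : B →ₗ[K] B) (hD₀ : IsDiffOpLE K q D₀)
    (hunit : IsUnit (D₀ g)) : T (-1 - ((q + a : ℕ) : ℤ)) = ⊤ := by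
  obtain ⟨u, hu⟩ := hunit
  refine (AddSubgroup.eq_top_iff' _).mpr fun h => ?_
  have hop : IsDiffOpLE K (q + a) ((h * ↑u⁻¹) • D₀) := (hD₀.smul (h * ↑u⁻¹)).of_le (Nat.le_add_right q a)
  have hmem := hneg (q + a) _ hop g (hcb hgT)
  rw [LinearMap.smul_apply, ← hu, smul_eq_mul, mul_assoc, Units.inv_mul, mul_one] at hmem
  exact hmem

end Squeeze

/-! ## 2. Specimen: the affine line, `𝔪 = (x)`, `g = x^q`, recipe `T(−a) = Diff^{≤ q+a}(𝔪^q)` -/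

section Specimen

variable (K : Type u) [CommRing K]

/-- The Hasse–Schmidt derivative `D^{(q)}` of `K[x]` has order `≤ q` and `D^{(q)}(x^q) = 1`: `x^q ∈ 𝔪^q` is a
(37)-type element of the degree-`q` piece `𝔪^q`, in every characteristic.
[cite: EGAIV4, Thm. 16.11.2 (16.11.2.1: D_p(z^q) = (q choose p) z^{q-p})] -/
theorem hasseDeriv_X_pow_self (q : ℕ) :
    IsDiffOpLE K q (hasseDeriv K (Finsupp.single (0 : Fin 1) q)) ∧
      hasseDeriv K (Finsupp.single (0 : Fin 1) q) ((MvPolynomial.X 0 : MvPolynomial (Fin 1) K) ^ q) = 1 :=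
  ⟨isDiffOpLE_hasseDeriv K q _ (by rw [Finsupp.degree_single]), by rw [hasseDeriv_X_pow]; simp⟩

/-- **Specimen.** On `K[x]` with `𝔪 = (x)`, for every `q` and every `a`: the ideal generated by the values of the
operators of order `≤ q + a` on `𝔪^q` — the one-term differential recipe for a «degree `−a` piece» attached to the
degree-`q` piece `𝔪^q` — is the unit ideal. Derived THROUGH (S1): the recipe is Diff-stable from source degree `q` by
construction (`Resolution.apply_mem_diffIdeal`) and `x^q` is a (37)-type element (`hasseDeriv_X_pow_self`); so the
hypotheses of the barrier are satisfiable by the most natural recipe and the conclusion then bites.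
[cite: EGAIV4, (16.8.5) and Eq. (16.8.5.1); Thm. 16.11.2] -/
theorem specimen_affineLine (q a : ℕ) :
    diffIdeal K (q + a) (MvPolynomial.idealOfVars (Fin 1) K ^ q) = ⊤ := by
  let 𝔪 : Ideal (MvPolynomial (Fin 1) K) := MvPolynomial.idealOfVars (Fin 1) K
  -- the recipe as a `ℤ`-indexed family: degree `i ≥ 0` ↦ `𝔪^i`, degree `−b < 0` ↦ `Diff^{≤ q+b}(𝔪^q)`
  let T : ℤ → AddSubgroup (MvPolynomial (Fin 1) K) := fun i =>
    if 0 ≤ i then (𝔪 ^ i.toNat).toAddSubgroup else (diffIdeal K (q + (-i).toNat) (𝔪 ^ q)).toAddSubgroup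
  have hTq : T q = (𝔪 ^ q).toAddSubgroup := by
    simp only [T, if_pos (Int.natCast_nonneg q), Int.toNat_natCast]
  obtain ⟨hD, hDx⟩ := hasseDeriv_X_pow_self K q
  have hx : (MvPolynomial.X 0 : MvPolynomial (Fin 1) K) ^ q ∈ T q := by
    rw [hTq]
    exact Ideal.pow_mem_pow (Ideal.subset_span (Set.mem_range_self 0)) q
  have hcross : ∀ D : MvPolynomial (Fin 1) K →ₗ[K] MvPolynomial (Fin 1) K, IsDiffOpLE K (q + a) D →
      ∀ f, f ∈ T q → D f ∈ T (-(a : ℤ)) := by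
    intro D hD' f hf
    rw [hTq] at hf
    rcases Nat.eq_zero_or_pos a with rfl | ha
    · simp only [T, Nat.cast_zero, neg_zero, le_refl, if_true, Int.toNat_zero, pow_zero, Ideal.one_eq_top]
      trivial
    · have hna : ¬ (0 : ℤ) ≤ -(a : ℤ) := by omega
      simp only [T, if_neg hna, neg_neg, Int.toNat_natCast]
      exact apply_mem_diffIdeal K hD' hf
  have htop := negPiece_eq_top K T q a hcross _ hx _ hD (by rw [hDx]; exact isUnit_one)
  rcases Nat.eq_zero_or_pos a with rfl | ha
  · rw [add_zero]
    exact Ideal.eq_top_of_isUnit_mem _ (apply_mem_diffIdeal K hD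
      (Ideal.pow_mem_pow (Ideal.subset_span (Set.mem_range_self 0)) q)) (by rw [hDx]; exact isUnit_one)
  · have hna : ¬ (0 : ℤ) ≤ -(a : ℤ) := by omega
    simp only [T, if_neg hna, neg_neg, Int.toNat_natCast] at htop
    exact (Submodule.toAddSubgroup_eq_top).1 htop

end Specimen

end NegativePartCollapse

/-! ## 3. The barrier statement -/

/-- **Barrier (negative part collapse under Diff-stability from a non-negative source degree), proved.** For every
commutative ring `K`, every commutative `K`-algebra `B`, every family of additive subgroups `T : ℤ → AddSubgroup B`
and every `q ≥ 0`: IF `T` is Diff-stable from the source degree `q` into the negative degrees — every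
`K`-differential operator of `B` of order `≤ q + a` (Grothendieck, ÉGA IV₄ 16.8.1 / 16.8.8 (b), tree `Resolution.IsDiffOpLE`)
maps `T(q)` into `T(−a)`, for every `a ≥ 0` — AND `T(q)` carries a (37)-type element (`g ∈ T(q)` with an operator `D₀` of
order `≤ q` such that `D₀ g` is a unit), THEN no negative piece is proper: `T(−a) = B` for all `a ≥ 0`. Mechanism: `Diff^{≤ n}`
is a left `B`-module, `(hD)(t) = h·D(t)` [cite: EGAIV4, (16.8.5) and Eq. (16.8.5.1)], and increasing in `n`
[cite: EGAIV4, Déf. 16.8.1 and Prop. 16.8.8 (b)]; so `h = ((h (D₀g)⁻¹)·D₀)(g) ∈ T(−a)`. Proof: `NegativePartCollapse.negPiece_eq_top`;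
variants `squeeze_pos_source` / `squeeze_zero_source` (the cell's forms of record) and `negPiece_eq_top_of_crossBoundary`
(Diff-stability from negative sources only + antitonicity across the boundary); specimen `specimen_affineLine`
(`Diff^{≤ q+a}((x)^q) = K[x]` via `D^{(q)}(x^q) = 1` [cite: EGAIV4, Thm. 16.11.2]).

Technique class, in prose: «negative parts» of a graded / filtered algebra of ideals MANUFACTURED BY DIFFERENTIAL OPERATORS
from the non-negative pieces — `N(−a) ⊇ Diff^{(q+a)} · P(q)` with ABSOLUTE operators `Diff_{Z/K}` of unbounded order — at
points where some positive piece `P(q)` contains an element of order exactly `q` detected by an operator of order `q`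
(a unit value), with PROPERNESS of some negative piece (`N(−a) ≠ O`, «`℘nega` carries information») load-bearing downstream.

BARRIER (D-0021):
- technique_class: negative-part-by-differential-operators absolute-diff-stability crossing-source-degree unit-producing-operator order-q-element diff-module-structure graded-ideal-filtration positive-characteristic characteristic-free
- blocks: (1) every recipe / axiom system for a `ℤ`-graded family of additive pieces `T(i) ⊂ B` that demands BOTH (F3-type) stability under ALL `K`-differential operators from some source degree `q ≥ 0` downwards (`ord D ≤ q + a ⇒ D·T(q) ⊆ T(−a)`) AND (F7-type) a proper negative piece `T(−a) ≠ B` at a datum where `T(q)` holds a (37)-type element — the conjunction is unsatisfiable (`NegativePartCollapseUnderDiffStability`); (2) in particular the cell res-hironaka's scoring structures `Campaign.PnegaInterfaceV2` / `PnegaInterface` (Summits side, fields F2 `pos_eq` + F3 `diff_mem` + F7b `neg_proper`; cited by name) are EMPTY for every candidate («res-adj-1 E-B (kernel)», `INTERFACE-CHECK-v02-kernel.lean` ffc08c73dddd7ea4: `V2.tilde_neg_eq_top`, `V2.isEmpty`; director-resolution 2026-08-27T01:55:25Z finding of record); (3) the typed Def. 5.1 / Eq. (36) recipe of the 2017 Hironaka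 manuscript, p.25 l.38–41 «`℘̃(E,−a) = Σ_{dm ≥ |a|} Diff^{(dm+a)}_Z ℘posi(E,dm)`», at every point carrying the element of Eq. (37) p.26 l.25 / p.27 l.24 «`Diff^{(md′−md)} g^{d′−d} = O_{Z,ξ}`» — assumed «at every `ξ ∈ Sing(E)_cl`» p.26 l.36–37 — yields `℘̃(E,−a)_ξ = O_ξ` for all `a ≥ 0` (`Literature.AlgebraicGeometry.Hironaka2017.S05NegativePart.pTildeNeg_natCast_eq_top_of_clause`, `…S07Permissible.pNegaAt_eq_top_of_edgeDatum`, tree `Proofs/S07Permissible/Thm7p12.lean`; cell GAP-LEDGER row R01, class DEFECT-definitional, evidence `res-adj-1-G1Collapse.lean`) [claim: Hironaka2017, status: under-review] — a CANDIDATE statement under adjudication (D-0012), not asserted here; (4) the variant demanding Diff-stability only at source degree `0` (`squeeze_zero_source`) or only at negative sources together with antitonicity across the boundary `T(q) ⊆ T(−1)` (`negPiece_eq_top_of_crossBoundary`, the cell's E-E).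
- because: the `K`-differential operators of order `≤ n` form a left `B`-module — `(hD)(t) = h·D(t)` [cite: EGAIV4, (16.8.5) and Eq. (16.8.5.1)] (tree `IsDiffOpLE.smul`) — and `Diff^{≤ q} ⊆ Diff^{≤ q+a}` [cite: EGAIV4, Déf. 16.8.1 and Prop. 16.8.8 (b)] (tree `IsDiffOpLE.of_le`); a (37)-type element `g ∈ T(q)` with `D₀ g` a unit therefore produces EVERY `h ∈ B` as `((h (D₀ g)⁻¹)·D₀)(g)`, an operator of order `≤ q ≤ q + a` applied to `T(q)`, which Diff-stability into degree `−a` places in `T(−a)`. Nothing else is used: no multiplicativity, no antitonicity, no `p`-th roots, no Noetherian / regular / characteristic hypothesis.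
- evasions_known: (i) VACATE THE NEGATIVE DEGREES — carry the needed information in non-negative degrees only (the cell's line W1.3; F7 vacated), to which (S1) says nothing; (ii) RELATIVE operators — demand stability only under differential operators relative to a subring `β ⊇ ρ^e(O)` of `p^e`-th powers / of bounded order `< q` («Frobenius sandwich», the cell's line W1.4; Kawanoue's `Diff^{≤ p^e−1}`-stable ideals [cite: Kawanoue2007, Prop. 1.3.1.2]): then `D₀` with a unit value on `g` need not be admissible and (S1) does not apply — that class meets the SEPARATE obstruction `BoxMonomialUnits` (same directory) instead; (iii) bound the ORDER of the admitted operators by the source degree (`ord D ≤ i` at source `i`, targets `≥ 0` only: the Th. 4.1-shape Diff-stability of the positive algebra `℘(E)`), i.e. never let an operator cross into negative degrees — harmless by construction, but then the negative pieces are not manufactured by `Diff` at all; (iv) Diff-stability from NEGATIVE source degrees only (interface V3 field `diff_mem_neg`) WITHOUT antitonicity across the boundary — (S3) shows that adding `T(q) ⊆ T(−1)` re-imports the collapse; (v) work at points with NO (37)-type element in the source degree (no `g ∈ T(q)` on which some order-`≤ q` operator takes a unit value) — but the manuscript's own standing assumption p.26 l.36–37 posits the element of Eq. (37) at every singular point it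 treats and p.27 l.24 asserts the unit clause «`Diff^{(md′−md)} g^{d′−d} = O_{Z,ξ}`» for it (typed `S05NegativePart.U27L24`; kernel at regular points carrying an edge datum: `S07Permissible.pNegaAt_eq_top_of_edgeDatum`, cited by name) [claim: Hironaka2017, status: under-review]; on the affine line the Hasse–Schmidt derivative `D^{(q)}` does it for `x^q` (`NegativePartCollapse.hasseDeriv_X_pow_self` [cite: EGAIV4, Thm. 16.11.2]).
- scope_caveats: (a) proved for arbitrary commutative `K`, `B`, `T : ℤ → AddSubgroup B` (ideal- or module-valued pieces are covered through `toAddSubgroup`); (b) the hypotheses are quantified ABSTRACTLY — which printed or candidate recipe satisfies «Diff-stable from source degree `q` into degree `−a`» and «(37)-type element» is an interpretive question settled elsewhere (for the manuscript's Def. 5.1 see blocks (3) and the cell's GAP-LEDGER R01; HONEST FRAMING in the module docstring); (c) the unit clause is on ONE value `D₀ g`; with `D₀ g` merely non-zero in a domain one gets `T(−a) ⊇ (D₀ g)·B`-many elements only after dividing — not covered; (d) nothing here bears on the EXISTENCE of resolutions, embedded or otherwise, in characteristic `p`, nor on recipes that give up absolute Diff-stability or the negative degrees (evasions (i)–(i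ii)).
- status: established (kernel-checked in the stated generality; specimen `K[x]` for every `K`, `q`, `a`)
-/
theorem NegativePartCollapseUnderDiffStability :
    ¬ ∃ (K : Type u) (_ : CommRing K) (B : Type v) (_ : CommRing B) (_ : Algebra K B)
        (T : ℤ → AddSubgroup B) (q : ℕ),
        (∀ (a : ℕ) (D : B →ₗ[K] B), IsDiffOpLE K (q + a) D → ∀ f : B, f ∈ T q → D f ∈ T (-(a : ℤ))) ∧
        (∃ (g : B) (D₀ : B →ₗ[K] B), g ∈ T q ∧ IsDiffOpLE K q D₀ ∧ IsUnit (D₀ g)) ∧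
        ∃ a : ℕ, T (-(a : ℤ)) ≠ ⊤ := by
  rintro ⟨K, _, B, _, _, T, q, hcross, ⟨g, D₀, hgT, hD₀, hunit⟩, a, hne⟩
  exact hne (NegativePartCollapse.negPiece_eq_top K T q a (hcross a) g hgT D₀ hD₀ hunit)

/-- The barrier in its positive form (every negative piece is everything), for citation by consumers that hold the
data unbundled. [cite: EGAIV4, (16.8.5) and Eq. (16.8.5.1); Déf. 16.8.1] -/
theorem negPiece_eq_top_of_diffStable_of_unitValue {K : Type u} [CommRing K] {B : Type v} [CommRing B] [Algebra K B]
    (T : ℤ → AddSubgroup B) (q : ℕ)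
    (hcross : ∀ (a : ℕ) (D : B →ₗ[K] B), IsDiffOpLE K (q + a) D → ∀ f : B, f ∈ T q → D f ∈ T (-(a : ℤ)))
    {g : B} (hgT : g ∈ T q) {D₀ : B →ₗ[K] B} (hD₀ : IsDiffOpLE K q D₀) (hunit : IsUnit (D₀ g)) (a : ℕ) :
    T (-(a : ℤ)) = ⊤ :=
  NegativePartCollapse.negPiece_eq_top K T q a (hcross a) g hgT D₀ hD₀ hunit

/-- The barrier for IDEAL-valued pieces (the shape of the ℘nega recipes: `T(i) ⊂ B` ideals), through `toAddSubgroup`.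
[cite: EGAIV4, (16.8.5) and Eq. (16.8.5.1); Déf. 16.8.1] -/
theorem idealNegPiece_eq_top_of_diffStable_of_unitValue {K : Type u} [CommRing K] {B : Type v} [CommRing B]
    [Algebra K B] (T : ℤ → Ideal B) (q : ℕ)
    (hcross : ∀ (a : ℕ) (D : B →ₗ[K] B), IsDiffOpLE K (q + a) D → ∀ f : B, f ∈ T q → D f ∈ T (-(a : ℤ)))
    {g : B} (hgT : g ∈ T q) {D₀ : B →ₗ[K] B} (hD₀ : IsDiffOpLE K q D₀) (hunit : IsUnit (D₀ g)) (a : ℕ) :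
    T (-(a : ℤ)) = ⊤ :=
  (Submodule.toAddSubgroup_eq_top).1 (NegativePartCollapse.negPiece_eq_top K (fun i => (T i).toAddSubgroup) q a
    (fun D hD f hf => hcross a D hD f hf) g hgT D₀ hD₀ hunit)

end Literature.Barriers.ResolutionOfSingularities

end
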